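import Mathlib
import HarnessLib
import Summits.PneNP.PneNP.Theorems.OverlapGapAlgebraSearchHardWindowLocalRungPatterns
import Summits.PneNP.PneNP.Theorems.OverlapGapAlgebraSearchHardWindowLocalRungHall

/-!
# PneNP / OverlapGapAlgebra — `SearchHardWindow`: tightness of the occurrence-local rung

Support for crux `stmt-PneNP-2460` (`Summit.PneNP.PneNP.Theses.OverlapGapAlgebra.SearchHardWindow`),
ninth file of the OCCURRENCE-LOCAL RUNG (prefix `shwL_`). The rung (`…LocalRung.lean`:
occurrence-local rules fail on `F_k(n, ⌊αn⌋)` for every `α > 1`) is complemented by the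
matched-formula decoder: for `k ≥ 2`, `0 < α` and `e² α^{k-1} < 1` — i.e. every
`α < e^{-2/(k-1)}`, a bound tending to `1` as `k → ∞` — occurrence-local rules SUCCEED with
probability `1 - O(1/n)`. So the density hypothesis of the rung is optimal up to the factor
`e^{2/(k-1)}` (the exact threshold for the class is the 1-orientability density of the random
`k`-uniform hypergraph, not formalised here).

* `shwL_exists_decoder` — a matchable pattern (system of distinct representatives
  `i ↦ f i ∈ vars(clause i)`) carries an occurrence-local solver of its sign cube solving EVERY sign
  pattern: set each representative variable to the polarity of its occurrence in its clause;
* `shwL_localRules_succeed_below` — an occurrence-local family with success probability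
  `≥ 1 - (r/(1-r)²)/n` on `F_k(n, ⌊αn⌋)` for every `n ≥ 1` (`r = e² α^{k-1}`; Hall computation of
  `…LocalRungHall.lean`, fibre decomposition of `…LocalRungPatterns.lean`);
* `shwL_rung_fails_below` — hence the conclusion of `shwL_ratio_eventually_le` is FALSE at such
  `α`: some occurrence-local family has success probability not tending to `0`.

No definitions; axioms `propext`, `Classical.choice`, `Quot.sound`.
-/

set_option linter.dupNamespace false -- `Summit.PneNP.PneNP.…`: summit = sub-problem (D-0017)

namespace Summit.PneNP.PneNP.Theorems

open Finset

section Decoder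

variable {m k n : ℕ}

/-- **The matched-formula decoder.** For a matchable variable pattern (a system of distinct
representatives `i ↦ f i ∈ vars(clause i)` exists) there is an OCCURRENCE-LOCAL solver on the
sign cube solving EVERY sign pattern: set the representative variable of each clause to the
polarity of its occurrence in that clause (all other variables arbitrarily). -/
theorem shwL_exists_decoder (V : Fin m × Fin k → Fin n)
    (hV : ∃ f : Fin m → Fin n, Function.Injective f ∧ ∀ i, ∃ j, V (i, j) = f i) :
    ∃ dec : (Fin m × Fin k → Bool) → (Fin n → Bool),
      (∀ v : Fin n, ∀ S S' : Fin m × Fin k → Bool,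
        (∀ a, V a = v → S a = S' a) → dec S v = dec S' v) ∧
      ∀ S : Fin m × Fin k → Bool, ∀ i : Fin m, ∃ j : Fin k, dec S (V (i, j)) = S (i, j) := by
  classical
  obtain ⟨f, hf, hrep⟩ := hV
  choose jsel hjsel using hrep
  refine ⟨fun S v => if h : ∃ i, f i = v then S (h.choose, jsel h.choose) else false, ?_, ?_⟩
  · intro v S S' hSS'
    by_cases h : ∃ i, f i = v
    · simp only [dif_pos h]
      apply hSS'
      rw [hjsel]; exact h.choose_spec
    · simp only [dif_neg h]
  · intro S i
    refine ⟨jsel i, ?_⟩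
    have h : ∃ i', f i' = V (i, jsel i) := ⟨i, (hjsel i).symm⟩
    simp only [dif_pos h]
    have : h.choose = i := hf (h.choose_spec.trans (hjsel i))
    rw [this]

end Decoder

section Tightness

open Filter

/-- **Tightness of the occurrence-local rung: below `e^{-2/(k-1)}` the local rules succeed.** For
`k ≥ 2`, `0 < α` and `e² α^{k-1} < 1` there is an occurrence-local solver family (the
matched-formula decoder on matchable patterns) solving `F_k(n, ⌊αn⌋)` with probability at least
`1 - (r/(1-r)²)/n`, `r = e² α^{k-1}`, for every `n ≥ 1` — so the density hypothesis `α > 1` of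
`shwL_ratio_eventually_le` cannot be lowered below `e^{-2/(k-1)} → 1` (`k → ∞`); the true threshold
for the class is the 1-orientability density of the random `k`-uniform hypergraph. -/
theorem shwL_localRules_succeed_below (k : ℕ) (hk : 2 ≤ k) (α : ℝ) (hα : 0 < α)
    (hr : Real.exp 2 * α ^ (k - 1) < 1) :
    ∃ A : (n m : ℕ) → (Fin m → Fin k → Fin n × Bool) → (Fin n → Bool),
      (∀ n m : ℕ, ∀ Φ Ψ : Fin m → Fin k → Fin n × Bool, (∀ i j, (Φ i j).1 = (Ψ i j).1) →
        ∀ v : Fin n, (∀ i j, (Φ i j).1 = v → (Φ i j).2 = (Ψ i j).2) → A n m Φ v = A n m Ψ v) ∧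
      ∀ n : ℕ, 0 < n → ∀ m : ℕ, m = ⌊α * n⌋₊ →
        1 - (Real.exp 2 * α ^ (k - 1)) / (1 - Real.exp 2 * α ^ (k - 1)) ^ 2 / n
          ≤ (((univ : Finset (Fin m → Fin k → Fin n × Bool)).filter fun Φ =>
              ∀ i, ∃ j, A n m Φ (Φ i j).1 = (Φ i j).2).card : ℝ)
            / Fintype.card (Fin m → Fin k → Fin n × Bool) := by
  classical
  -- `α < 1`
  have hα1 : α < 1 := by
    by_contra h
    push Not at h
    have h1 : (1 : ℝ) ≤ α ^ (k - 1) := one_le_pow₀ h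
    have h2 : (1 : ℝ) < Real.exp 2 := by
      rw [← Real.exp_zero]; exact Real.exp_lt_exp.2 (by norm_num)
    nlinarith
  -- the decoder per pattern
  set decOf : (m n : ℕ) → (Fin m × Fin k → Fin n) → (Fin m × Fin k → Bool) → (Fin n → Bool) :=
    fun m n V => if hV : ∃ f : Fin m → Fin n, Function.Injective f ∧ ∀ i, ∃ j, V (i, j) = f i
      then (shwL_exists_decoder V hV).choose else fun _ _ => false with hdecOf
  have hdec_loc : ∀ m n (V : Fin m × Fin k → Fin n) (v : Fin n) (S S' : Fin m × Fin k → Bool),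
      (∀ a, V a = v → S a = S' a) → decOf m n V S v = decOf m n V S' v := by
    intro m n V v S S' hSS'
    simp only [hdecOf]
    split_ifs with hV
    · exact (shwL_exists_decoder V hV).choose_spec.1 v S S' hSS'
    · rfl
  have hdec_solves : ∀ m n (V : Fin m × Fin k → Fin n),
      (∃ f : Fin m → Fin n, Function.Injective f ∧ ∀ i, ∃ j, V (i, j) = f i) →
        ∀ S : Fin m × Fin k → Bool, ∀ i : Fin m, ∃ j : Fin k, decOf m n V S (V (i, j)) = S (i, j) := by
    intro m n V hV S
    simp only [hdecOf, dif_pos hV]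
    exact (shwL_exists_decoder V hV).choose_spec.2 S
  refine ⟨fun n m Φ => decOf m n (fun a => (Φ a.1 a.2).1) (fun a => (Φ a.1 a.2).2), ?_, ?_⟩
  · -- occurrence-locality
    intro n m Φ Ψ hV v hS
    have hpat : (fun a : Fin m × Fin k => (Ψ a.1 a.2).1) = fun a => (Φ a.1 a.2).1 :=
      funext fun a => (hV a.1 a.2).symm
    show decOf m n (fun a => (Φ a.1 a.2).1) (fun a => (Φ a.1 a.2).2) v
      = decOf m n (fun a => (Ψ a.1 a.2).1) (fun a => (Ψ a.1 a.2).2) v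
    rw [hpat]
    exact hdec_loc m n _ v _ _ fun a ha => hS a.1 a.2 ha
  · -- success probability
    intro n hn m hm
    set r : ℝ := Real.exp 2 * α ^ (k - 1) with hrdef
    have hmle : (m : ℝ) ≤ α * n := by rw [hm]; exact Nat.floor_le (by positivity)
    have hmn : m ≤ n + 1 := by
      have : (m : ℝ) ≤ n := hmle.trans (by nlinarith [show (0 : ℝ) < n by exact_mod_cast hn])
      exact_mod_cast this.trans (by linarith : (n : ℝ) ≤ n + 1)
    -- count: every instance with a matchable pattern is solved
    have hNS : (0 : ℝ) < Fintype.card (Fin m × Fin k → Bool) := by exact_mod_cast Fintype.card_pos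
    have hNV : (0 : ℝ) < Fintype.card (Fin m × Fin k → Fin n) := by
      haveI : Nonempty (Fin n) := ⟨⟨0, hn⟩⟩
      exact_mod_cast Fintype.card_pos
    have hcount : ((univ.filter fun V : Fin m × Fin k → Fin n =>
        ∃ f : Fin m → Fin n, Function.Injective f ∧ ∀ i, ∃ j, V (i, j) = f i).card : ℝ)
          * Fintype.card (Fin m × Fin k → Bool)
        ≤ ((univ : Finset (Fin m → Fin k → Fin n × Bool)).filter fun Φ => ∀ i, ∃ j,
            decOf m n (fun a => (Φ a.1 a.2).1) (fun a => (Φ a.1 a.2).2) (Φ i j).1 = (Φ i j).2).card := by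
      rw [shwL_card_solved_eq_sum]
      have hfib : ∀ V : Fin m × Fin k → Fin n,
          (∃ f : Fin m → Fin n, Function.Injective f ∧ ∀ i, ∃ j, V (i, j) = f i) →
            ((univ.filter fun S : Fin m × Fin k → Bool => ∀ i, ∃ j,
              decOf m n (fun a : Fin m × Fin k => V (a.1, a.2)) (fun a : Fin m × Fin k => S (a.1, a.2))
                (V (i, j)) = S (i, j)).card : ℝ) = Fintype.card (Fin m × Fin k → Bool) := by
        intro V hV
        have hVeta : (fun a : Fin m × Fin k => V (a.1, a.2)) = V := funext fun a => rfl
        have hall : (univ.filter fun S : Fin m × Fin k → Bool => ∀ i, ∃ j,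
            decOf m n (fun a : Fin m × Fin k => V (a.1, a.2)) (fun a : Fin m × Fin k => S (a.1, a.2))
              (V (i, j)) = S (i, j)) = univ := by
          ext S
          have hSeta : (fun a : Fin m × Fin k => S (a.1, a.2)) = S := funext fun a => rfl
          simp only [mem_filter, mem_univ, true_and, iff_true, hVeta, hSeta]
          exact hdec_solves m n V hV S
        rw [hall, card_univ]
      push_cast
      calc ((univ.filter fun V : Fin m × Fin k → Fin n =>
            ∃ f : Fin m → Fin n, Function.Injective f ∧ ∀ i, ∃ j, V (i, j) = f i).card : ℝ)
              * Fintype.card (Fin m × Fin k → Bool)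
          = ∑ V ∈ univ.filter (fun V : Fin m × Fin k → Fin n =>
              ∃ f : Fin m → Fin n, Function.Injective f ∧ ∀ i, ∃ j, V (i, j) = f i),
                (Fintype.card (Fin m × Fin k → Bool) : ℝ) := by rw [sum_const, nsmul_eq_mul]
        _ = ∑ V ∈ univ.filter (fun V : Fin m × Fin k → Fin n =>
              ∃ f : Fin m → Fin n, Function.Injective f ∧ ∀ i, ∃ j, V (i, j) = f i),
                ((univ.filter fun S : Fin m × Fin k → Bool => ∀ i, ∃ j,
                  decOf m n (fun a : Fin m × Fin k => V (a.1, a.2)) (fun a : Fin m × Fin k => S (a.1, a.2))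
                    (V (i, j)) = S (i, j)).card : ℝ) :=
            sum_congr rfl fun V hV => (hfib V (mem_filter.1 hV).2).symm
        _ ≤ ∑ V : Fin m × Fin k → Fin n, ((univ.filter fun S : Fin m × Fin k → Bool => ∀ i, ∃ j,
                  decOf m n (fun a : Fin m × Fin k => V (a.1, a.2)) (fun a : Fin m × Fin k => S (a.1, a.2))
                    (V (i, j)) = S (i, j)).card : ℝ) :=
            sum_le_sum_of_subset_of_nonneg (filter_subset _ _) fun _ _ _ => Nat.cast_nonneg _
    -- the non-matchable patterns are few
    have hbad := (shwL_ratio_notMatchable_le (k := k) hn hmn).trans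
      (shwL_sum_hallTerms_le k hk α hα hr hn hmle)
    rw [← hrdef] at hbad
    have hsplit := Finset.card_filter_add_card_filter_not (s := (univ : Finset (Fin m × Fin k → Fin n)))
      (fun V => ∃ f : Fin m → Fin n, Function.Injective f ∧ ∀ i, ∃ j, V (i, j) = f i)
    rw [card_univ] at hsplit
    have hsplitR : ((univ.filter fun V : Fin m × Fin k → Fin n =>
        ∃ f : Fin m → Fin n, Function.Injective f ∧ ∀ i, ∃ j, V (i, j) = f i).card : ℝ)
          + ((univ.filter fun V : Fin m × Fin k → Fin n =>
              ¬ ∃ f : Fin m → Fin n, Function.Injective f ∧ ∀ i, ∃ j, V (i, j) = f i).card : ℝ)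
        = Fintype.card (Fin m × Fin k → Fin n) := by exact_mod_cast hsplit
    rw [div_le_iff₀ hNV] at hbad
    rw [shwL_card_inst_eq, Nat.cast_mul, le_div_iff₀ (by positivity)]
    nlinarith [hcount, hbad, hsplitR, hNS, hNV]

/-- **Corollary: the rung's conclusion is FALSE below `e^{-2/(k-1)}`.** For `k ≥ 2`, `0 < α`,
`e² α^{k-1} < 1` there is an occurrence-local solver family whose success probability on
`F_k(n, ⌊αn⌋)` does not tend to `0`. -/
theorem shwL_rung_fails_below (k : ℕ) (hk : 2 ≤ k) (α : ℝ) (hα : 0 < α)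
    (hr : Real.exp 2 * α ^ (k - 1) < 1) :
    ∃ A : (n m : ℕ) → (Fin m → Fin k → Fin n × Bool) → (Fin n → Bool),
      (∀ n m : ℕ, ∀ Φ Ψ : Fin m → Fin k → Fin n × Bool, (∀ i j, (Φ i j).1 = (Ψ i j).1) →
        ∀ v : Fin n, (∀ i j, (Φ i j).1 = v → (Φ i j).2 = (Ψ i j).2) → A n m Φ v = A n m Ψ v) ∧
      ¬ ∀ ε : ℝ, 0 < ε → ∀ᶠ n : ℕ in atTop, ∀ m : ℕ, m = ⌊α * n⌋₊ →
        (((univ : Finset (Fin m → Fin k → Fin n × Bool)).filter fun Φ =>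
            ∀ i, ∃ j, A n m Φ (Φ i j).1 = (Φ i j).2).card : ℝ)
          / Fintype.card (Fin m → Fin k → Fin n × Bool) ≤ ε := by
  obtain ⟨A, hloc, hsucc⟩ := shwL_localRules_succeed_below k hk α hα hr
  refine ⟨A, hloc, fun H => ?_⟩
  set C : ℝ := (Real.exp 2 * α ^ (k - 1)) / (1 - Real.exp 2 * α ^ (k - 1)) ^ 2 with hC
  have hev := H (1 / 4) (by norm_num)
  have hlarge : ∀ᶠ n : ℕ in atTop, C / (n : ℝ) ≤ 1 / 4 :=
    (tendsto_const_div_atTop_nhds_zero_nat C).eventually (ge_mem_nhds (by norm_num))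
  obtain ⟨n, hn₁, hn₂, hn₃⟩ := (hev.and (hlarge.and (eventually_ge_atTop 1))).exists
  have h₁ := hn₁ _ rfl
  have h₂ := hsucc n hn₃ _ rfl
  linarith

end Tightness

end Summit.PneNP.PneNP.Theorems
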